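import Summits.Ventures.DiscreteObjects.PP12.FanoExterior

/-!
# PP(12), order-5 cell: tangent and exterior LINES around the fixed Fano subplane (kernel; sequel to `FanoExterior`)
Framing: lottery ticket; floor = certified bounds/negative ranges.

Same setting as `FanoExterior.lean` (collineation `σ` of a projective plane of order 12 whose fixed structure is a Fano subplane:
7 fixed points, 7 fixed lines, 3 fixed points per fixed line, 3 fixed lines per fixed point — the output of `fano_of_pow_five`,
p220694, for any `σ ≠ 1` with `σ⁵ = 1`). Proved here (cell pub-namedobj, target M, designs g10, FAMILY P5-PLANE §1):

* a TANGENT line (non-fixed, through a fixed point) carries exactly 1 fixed point, 4 tangent points and 8 exterior points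
  (`tangent_line_counts_fano`);
* an EXTERIOR line (through no fixed point) is not fixed and carries exactly 7 tangent points and 6 exterior points
  (`exterior_line_counts_fano`);
* the packaged statement for `σ⁵ = 1`, `σ ≠ 1` on a plane of order 12 (`fano_exterior_structure`), and the dual counts: exactly
  70 tangent lines and 80 exterior lines (`card_tangent_exterior_lines_fano`).

Elementary counting only; no `sorry`, no new axioms. The census elimination of this cell (Janko–van Trung 1982, `p = 5`) is
computational and NOT in the kernel.
-/

namespace Summit.Ventures.DiscreteObjects.PP12

open Configuration Finset
open scoped Classical

namespace Collineation

variable {P L : Type*} [Membership P L] [ProjectivePlane P L] [Fintype P] [Fintype L]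
  [DecidableEq P] [DecidableEq L] (σ : Collineation P L)

section Fano

variable (h12 : ProjectivePlane.order P L = 12)
include h12

/-- **Tangent lines.** A non-fixed line `t` through a fixed point `X` carries exactly 1 fixed point, exactly 4 tangent points and
exactly 8 exterior points. -/
theorem tangent_line_counts_fano (hg7 : fixedCard σ.onLines = 7) (ht3 : ∀ x : P, σ.onPoints x = x → σ.fixedThrough x = 3)
    {t : L} (ht : σ.onLines t ≠ t) {X : P} (hX : σ.onPoints X = X) (hXt : X ∈ t) :
    σ.fixedOnLine t = 1 ∧
    (univ.filter fun y : P => y ∈ t ∧ σ.onPoints y ≠ y ∧ ∃ l : L, σ.onLines l = l ∧ y ∈ l).card = 4 ∧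
    (univ.filter fun y : P => y ∈ t ∧ σ.onPoints y ≠ y ∧ ∀ l : L, σ.onLines l = l → y ∉ l).card = 8 := by
  -- (1) exactly one fixed point on t
  have h1 : σ.fixedOnLine t = 1 := by
    unfold fixedOnLine
    rw [Finset.card_eq_one]
    refine ⟨X, ?_⟩
    ext y
    simp only [mem_filter, mem_univ, true_and, mem_singleton]
    constructor
    · rintro ⟨hyt, fy⟩; exact σ.fixed_point_unique_of_not_fixed ht fy hX hyt hXt
    · rintro rfl; exact ⟨hXt, hX⟩
  -- (2) tangent points on t ↔ fixed lines not through X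
  set T : Finset L := univ.filter fun m : L => σ.onLines m = m with hT
  set TX : Finset L := T.filter fun m => X ∉ m with hTX
  have hTXcard : TX.card = 4 := by
    have h3 : (T.filter fun m => X ∈ m).card = 3 := by
      have := ht3 X hX
      unfold fixedThrough at this
      rw [← this]; congr 1; ext m; simp [hT, and_comm]
    have hsplit := Finset.card_filter_add_card_filter_not (s := T) (fun m : L => X ∈ m)
    have hTcard : T.card = 7 := hg7
    rw [h3, hTcard] at hsplit
    simpa [hTX] using (by omega : (T.filter fun m => ¬ X ∈ m).card = 4)
  set Tg : Finset P := univ.filter fun y : P => y ∈ t ∧ σ.onPoints y ≠ y ∧ ∃ l : L, σ.onLines l = l ∧ y ∈ l with hTg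
  have hmeet : ∀ m ∈ TX, m ≠ t := fun m hm e => by
    have := (Finset.mem_filter.mp hm).2; exact this (e ▸ hXt)
  let ψ : L → P := fun m => if h : m ≠ t then HasPoints.mkPoint h else X
  have hψ : ∀ m ∈ TX, ψ m ∈ m ∧ ψ m ∈ t ∧ σ.onPoints (ψ m) ≠ ψ m := by
    intro m hm
    have hne := hmeet m hm
    have hXm : X ∉ m := (Finset.mem_filter.mp hm).2
    simp only [ψ, dif_pos hne]
    refine ⟨(HasPoints.mkPoint_ax hne).1, (HasPoints.mkPoint_ax hne).2, fun fy => ?_⟩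
    have := σ.fixed_point_unique_of_not_fixed ht fy hX (HasPoints.mkPoint_ax hne).2 hXt
    exact hXm (this ▸ (HasPoints.mkPoint_ax hne).1)
  have hψmaps : ∀ m ∈ TX, ψ m ∈ Tg := by
    intro m hm
    obtain ⟨h1m, h2m, h3m⟩ := hψ m hm
    have fm : σ.onLines m = m := by have := (Finset.mem_filter.mp hm).1; simpa [hT] using this
    simp only [hTg, mem_filter, mem_univ, true_and]
    exact ⟨h2m, h3m, m, fm, h1m⟩
  have hψinj : Set.InjOn ψ TX := by
    intro m hm m' hm' heq
    obtain ⟨h1m, -, h3m⟩ := hψ m hm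
    obtain ⟨h1m', -, -⟩ := hψ m' hm'
    have fm : σ.onLines m = m := by have := (Finset.mem_filter.mp hm).1; simpa [hT] using this
    have fm' : σ.onLines m' = m' := by have := (Finset.mem_filter.mp hm').1; simpa [hT] using this
    rw [← heq] at h1m'
    exact σ.fixed_line_unique_of_not_fixed h3m fm fm' h1m h1m'
  have hge : 4 ≤ Tg.card := by
    have := Finset.card_le_card_of_injOn ψ hψmaps hψinj
    rwa [hTXcard] at this
  -- reverse injection: tangent point y ↦ its fixed line, which misses X
  have hLpos : 0 < Fintype.card L := by rw [ProjectivePlane.card_lines P L]; positivity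
  obtain ⟨l₀⟩ := Fintype.card_pos_iff.mp hLpos
  let φ : P → L := fun y => if h : ∃ l : L, σ.onLines l = l ∧ y ∈ l then h.choose else l₀
  have hφ : ∀ y ∈ Tg, σ.onLines (φ y) = φ y ∧ y ∈ φ y ∧ X ∉ φ y := by
    intro y hy
    obtain ⟨hyt, hyfix, hex⟩ := by simpa [hTg] using hy
    have hc : σ.onLines (φ y) = φ y ∧ y ∈ φ y := by simp only [φ, dif_pos hex]; exact hex.choose_spec
    refine ⟨hc.1, hc.2, fun hXφ => ?_⟩
    have hyX : y ≠ X := fun e => hyfix (e ▸ hX)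
    have : φ y = t := (Nondegenerate.eq_or_eq hc.2 hXφ hyt hXt).resolve_left hyX
    exact ht (this ▸ hc.1)
  have hφmaps : ∀ y ∈ Tg, φ y ∈ TX := fun y hy => by
    obtain ⟨h1y, -, h3y⟩ := hφ y hy
    simp [hTX, hT, h1y, h3y]
  have hφinj : Set.InjOn φ Tg := by
    intro y hy y' hy' heq
    obtain ⟨h1y, h2y, -⟩ := hφ y hy
    obtain ⟨-, h2y', -⟩ := hφ y' hy'
    rw [← heq] at h2y'
    obtain ⟨hyt, hyfix, -⟩ := by simpa [hTg] using hy
    obtain ⟨hy't, -, -⟩ := by simpa [hTg] using hy'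
    by_contra hne
    have : φ y = t := (Nondegenerate.eq_or_eq h2y h2y' hyt hy't).resolve_left hne
    exact ht (this ▸ h1y)
  have hle : Tg.card ≤ 4 := by
    have := Finset.card_le_card_of_injOn φ hφmaps hφinj
    rwa [hTXcard] at this
  have h4 : Tg.card = 4 := le_antisymm hle hge
  -- (3) the remaining 8 points of t are exterior
  have hall : (univ.filter fun y : P => y ∈ t).card = 13 := by
    rw [← Fintype.card_subtype, ← Nat.card_eq_fintype_card]
    change Configuration.pointCount P t = 13
    rw [ProjectivePlane.pointCount_eq P t, h12]
  have hsplit1 := Finset.card_filter_add_card_filter_not (s := univ.filter fun y : P => y ∈ t)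
    (fun y : P => σ.onPoints y = y)
  have hfix1 : ((univ.filter fun y : P => y ∈ t).filter fun y => σ.onPoints y = y).card = 1 := by
    rw [← h1]; unfold fixedOnLine; congr 1; ext y; simp
  have hsplit2 := Finset.card_filter_add_card_filter_not
    (s := (univ.filter fun y : P => y ∈ t).filter fun y => ¬ σ.onPoints y = y)
    (fun y : P => ∃ l : L, σ.onLines l = l ∧ y ∈ l)
  have e1 : (((univ.filter fun y : P => y ∈ t).filter fun y => ¬ σ.onPoints y = y).filter
      fun y => ∃ l : L, σ.onLines l = l ∧ y ∈ l) = Tg := by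
    ext y; simp only [hTg, mem_filter, mem_univ, true_and, and_assoc]
  have e2 : (((univ.filter fun y : P => y ∈ t).filter fun y => ¬ σ.onPoints y = y).filter
      fun y => ¬ ∃ l : L, σ.onLines l = l ∧ y ∈ l)
      = univ.filter fun y : P => y ∈ t ∧ σ.onPoints y ≠ y ∧ ∀ l : L, σ.onLines l = l → y ∉ l := by
    ext y; simp only [mem_filter, mem_univ, true_and, not_exists, not_and, and_assoc]
  rw [e1, e2, h4] at hsplit2
  rw [hfix1, hall] at hsplit1
  refine ⟨h1, h4, ?_⟩
  omega

/-- **Exterior lines.** A line `e` carrying no fixed point is not fixed and carries exactly 7 tangent points (one on each fixed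
line) and exactly 6 exterior points. -/
theorem exterior_line_counts_fano (hg7 : fixedCard σ.onLines = 7) (hk3 : ∀ l : L, σ.onLines l = l → σ.fixedOnLine l = 3)
    {e : L} (he : ∀ x : P, σ.onPoints x = x → x ∉ e) :
    σ.onLines e ≠ e ∧
    (univ.filter fun y : P => y ∈ e ∧ σ.onPoints y ≠ y ∧ ∃ l : L, σ.onLines l = l ∧ y ∈ l).card = 7 ∧
    (univ.filter fun y : P => y ∈ e ∧ σ.onPoints y ≠ y ∧ ∀ l : L, σ.onLines l = l → y ∉ l).card = 6 := by
  -- e is not fixed: a fixed line carries 3 fixed points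
  have hefix : σ.onLines e ≠ e := by
    intro fe
    have h3 := hk3 e fe
    unfold fixedOnLine at h3
    obtain ⟨y, hy⟩ := Finset.card_pos.mp (by rw [h3]; norm_num : 0 < (univ.filter fun p : P => p ∈ e ∧ σ.onPoints p = p).card)
    simp only [mem_filter, mem_univ, true_and] at hy
    exact he y hy.2 hy.1
  set T : Finset L := univ.filter fun m : L => σ.onLines m = m with hT
  have hTcard : T.card = 7 := hg7
  set Tg : Finset P := univ.filter fun y : P => y ∈ e ∧ σ.onPoints y ≠ y ∧ ∃ l : L, σ.onLines l = l ∧ y ∈ l with hTg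
  -- the meet with each fixed line is a tangent point of e; injective
  have hmeet : ∀ m ∈ T, m ≠ e := fun m hm h => by
    have fm : σ.onLines m = m := by simpa [hT] using hm
    exact hefix (h ▸ fm)
  have hPpos : 0 < Fintype.card P := by rw [ProjectivePlane.card_points P L]; positivity
  obtain ⟨p₀⟩ := Fintype.card_pos_iff.mp hPpos
  let ψ : L → P := fun m => if h : m ≠ e then HasPoints.mkPoint h else p₀
  have hψ : ∀ m ∈ T, ψ m ∈ m ∧ ψ m ∈ e ∧ σ.onPoints (ψ m) ≠ ψ m := by
    intro m hm
    have hne := hmeet m hm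
    simp only [ψ, dif_pos hne]
    exact ⟨(HasPoints.mkPoint_ax hne).1, (HasPoints.mkPoint_ax hne).2, fun fy => he _ fy (HasPoints.mkPoint_ax hne).2⟩
  have hψmaps : ∀ m ∈ T, ψ m ∈ Tg := by
    intro m hm
    obtain ⟨h1m, h2m, h3m⟩ := hψ m hm
    have fm : σ.onLines m = m := by simpa [hT] using hm
    simp only [hTg, mem_filter, mem_univ, true_and]
    exact ⟨h2m, h3m, m, fm, h1m⟩
  have hψinj : Set.InjOn ψ T := by
    intro m hm m' hm' heq
    obtain ⟨h1m, -, h3m⟩ := hψ m hm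
    obtain ⟨h1m', -, -⟩ := hψ m' hm'
    have fm : σ.onLines m = m := by simpa [hT] using hm
    have fm' : σ.onLines m' = m' := by simpa [hT] using hm'
    rw [← heq] at h1m'
    exact σ.fixed_line_unique_of_not_fixed h3m fm fm' h1m h1m'
  have hge : 7 ≤ Tg.card := by
    have := Finset.card_le_card_of_injOn ψ hψmaps hψinj
    rwa [hTcard] at this
  -- reverse injection: tangent point ↦ its (unique) fixed line
  have hLpos : 0 < Fintype.card L := by rw [ProjectivePlane.card_lines P L]; positivity
  obtain ⟨l₀⟩ := Fintype.card_pos_iff.mp hLpos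
  let φ : P → L := fun y => if h : ∃ l : L, σ.onLines l = l ∧ y ∈ l then h.choose else l₀
  have hφ : ∀ y ∈ Tg, σ.onLines (φ y) = φ y ∧ y ∈ φ y := by
    intro y hy
    obtain ⟨-, -, hex⟩ := by simpa [hTg] using hy
    simp only [φ, dif_pos hex]; exact hex.choose_spec
  have hφmaps : ∀ y ∈ Tg, φ y ∈ T := fun y hy => by simp [hT, (hφ y hy).1]
  have hφinj : Set.InjOn φ Tg := by
    intro y hy y' hy' heq
    obtain ⟨h1y, h2y⟩ := hφ y hy
    obtain ⟨-, h2y'⟩ := hφ y' hy'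
    rw [← heq] at h2y'
    obtain ⟨hye, -, -⟩ := by simpa [hTg] using hy
    obtain ⟨hy'e, -, -⟩ := by simpa [hTg] using hy'
    by_contra hne
    have : φ y = e := (Nondegenerate.eq_or_eq h2y h2y' hye hy'e).resolve_left hne
    exact hefix (this ▸ h1y)
  have hle : Tg.card ≤ 7 := by
    have := Finset.card_le_card_of_injOn φ hφmaps hφinj
    rwa [hTcard] at this
  have h7 : Tg.card = 7 := le_antisymm hle hge
  -- the remaining 6 points of e are exterior
  have hall : (univ.filter fun y : P => y ∈ e).card = 13 := by
    rw [← Fintype.card_subtype, ← Nat.card_eq_fintype_card]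
    change Configuration.pointCount P e = 13
    rw [ProjectivePlane.pointCount_eq P e, h12]
  have hfix0 : ((univ.filter fun y : P => y ∈ e).filter fun y => σ.onPoints y = y).card = 0 := by
    rw [Finset.card_eq_zero, Finset.filter_eq_empty_iff]
    intro y hy fy
    simp only [mem_filter, mem_univ, true_and] at hy
    exact he y fy hy
  have hsplit1 := Finset.card_filter_add_card_filter_not (s := univ.filter fun y : P => y ∈ e)
    (fun y : P => σ.onPoints y = y)
  have hsplit2 := Finset.card_filter_add_card_filter_not
    (s := (univ.filter fun y : P => y ∈ e).filter fun y => ¬ σ.onPoints y = y)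
    (fun y : P => ∃ l : L, σ.onLines l = l ∧ y ∈ l)
  have e1 : (((univ.filter fun y : P => y ∈ e).filter fun y => ¬ σ.onPoints y = y).filter
      fun y => ∃ l : L, σ.onLines l = l ∧ y ∈ l) = Tg := by
    ext y; simp only [hTg, mem_filter, mem_univ, true_and, and_assoc]
  have e2 : (((univ.filter fun y : P => y ∈ e).filter fun y => ¬ σ.onPoints y = y).filter
      fun y => ¬ ∃ l : L, σ.onLines l = l ∧ y ∈ l)
      = univ.filter fun y : P => y ∈ e ∧ σ.onPoints y ≠ y ∧ ∀ l : L, σ.onLines l = l → y ∉ l := by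
    ext y; simp only [mem_filter, mem_univ, true_and, not_exists, not_and, and_assoc]
  rw [e1, e2, h7] at hsplit2
  rw [hfix0, hall] at hsplit1
  refine ⟨hefix, h7, ?_⟩
  omega

end Fano

/-- **The order-5 cell of PP(12), packaged.** For a projective plane of order 12 and a collineation `σ ≠ 1` with `σ⁵ = 1` on
points (so its fixed structure is a Fano subplane, `fano_of_pow_five`): 70 tangent and 80 exterior points; an exterior point lies on
exactly 7 lines carrying a fixed point and on exactly 6 lines carrying none; a non-fixed line through a fixed point carries exactly
1 fixed, 4 tangent and 8 exterior points; a line carrying no fixed point is non-fixed and carries exactly 7 tangent and 6 exterior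
points. (FAMILY P5-PLANE §1; the census elimination of this cell is computational and NOT in the kernel.) -/
theorem fano_exterior_structure (h12 : ProjectivePlane.order P L = 12) (hne : σ.onPoints ≠ 1) (hq : σ.onPoints ^ 5 = 1) :
    (univ.filter fun x : P => σ.onPoints x ≠ x ∧ ∃ l : L, σ.onLines l = l ∧ x ∈ l).card = 70 ∧
    (univ.filter fun x : P => σ.onPoints x ≠ x ∧ ∀ l : L, σ.onLines l = l → x ∉ l).card = 80 ∧
    (∀ E : P, (∀ l : L, σ.onLines l = l → E ∉ l) →
      (univ.filter fun m : L => E ∈ m ∧ ∃ x : P, σ.onPoints x = x ∧ x ∈ m).card = 7 ∧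
      (univ.filter fun m : L => E ∈ m ∧ ∀ x : P, σ.onPoints x = x → x ∉ m).card = 6) ∧
    (∀ (t : L) (X : P), σ.onLines t ≠ t → σ.onPoints X = X → X ∈ t →
      σ.fixedOnLine t = 1 ∧
      (univ.filter fun y : P => y ∈ t ∧ σ.onPoints y ≠ y ∧ ∃ l : L, σ.onLines l = l ∧ y ∈ l).card = 4 ∧
      (univ.filter fun y : P => y ∈ t ∧ σ.onPoints y ≠ y ∧ ∀ l : L, σ.onLines l = l → y ∉ l).card = 8) ∧
    (∀ e : L, (∀ x : P, σ.onPoints x = x → x ∉ e) →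
      σ.onLines e ≠ e ∧
      (univ.filter fun y : P => y ∈ e ∧ σ.onPoints y ≠ y ∧ ∃ l : L, σ.onLines l = l ∧ y ∈ l).card = 7 ∧
      (univ.filter fun y : P => y ∈ e ∧ σ.onPoints y ≠ y ∧ ∀ l : L, σ.onLines l = l → y ∉ l).card = 6) := by
  obtain ⟨hf7, hg7, hk3, ht3⟩ := σ.fano_of_pow_five h12 hne hq
  refine ⟨σ.card_tangent_points_fano h12 hg7 hk3, σ.card_exterior_points_fano h12 hf7 hg7 hk3,
    fun E hE => (σ.lines_through_exterior_fano h12 hf7 hE).2,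
    fun t X ht hX hXt => σ.tangent_line_counts_fano h12 hg7 ht3 ht hX hXt,
    fun e he => σ.exterior_line_counts_fano h12 hg7 hk3 he⟩

/-- **Dual counts.** Under the same hypotheses there are exactly 70 tangent LINES (non-fixed, through a fixed point) and exactly 80
exterior LINES (through no fixed point) — `card_tangent_points_fano` / `card_exterior_points_fano` for the dual collineation. -/
theorem card_tangent_exterior_lines_fano (h12 : ProjectivePlane.order P L = 12) (hne : σ.onPoints ≠ 1)
    (hq : σ.onPoints ^ 5 = 1) :
    (univ.filter fun m : L => σ.onLines m ≠ m ∧ ∃ x : P, σ.onPoints x = x ∧ x ∈ m).card = 70 ∧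
    (univ.filter fun m : L => σ.onLines m ≠ m ∧ ∀ x : P, σ.onPoints x = x → x ∉ m).card = 80 := by
  obtain ⟨hf7, hg7, hk3, ht3⟩ := σ.fano_of_pow_five h12 hne hq
  have h12' : ProjectivePlane.order (Dual L) (Dual P) = 12 := by rw [ProjectivePlane.Dual.order]; exact h12
  have hk3' : ∀ x : Dual P, σ.dual.onLines x = x → σ.dual.fixedOnLine x = 3 := fun x hx => by
    rw [← fixedThrough_eq_dual]; exact ht3 x hx
  exact ⟨σ.dual.card_tangent_points_fano h12' hf7 hk3', σ.dual.card_exterior_points_fano h12' hg7 hf7 hk3'⟩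

end Collineation

end Summit.Ventures.DiscreteObjects.PP12
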